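import Literature.NumberTheory.EllipticCurves.CuspFormsGamma0IntegralBasisProofs
import Literature.NumberTheory.EllipticCurves.CongruenceNumber
import HarnessLib

/-!
# Crux K `TorsionSharingPrimeBound` (stmt-ABC-2157), line `SketchIdeator3g2` — sub-goal
# `exists_latticeBasis_integralCuspForms0`

For `k ≥ 2` the group `S_k(Γ₀(N); ℤ) = integralCuspForms0 N k` of cusp forms on `Γ₀(N)` all of
whose Fourier coefficients at `∞` are rational integers is a **full lattice** of `S_k(Γ₀(N))`: it
has a `ℤ`-basis `b` which is at the same time a `ℂ`-basis of `S_k(Γ₀(N))`, so that every integral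
form has *integer* coordinates in `b`.

Proof. (1) Shimura 1971, Thm. 3.52 (tree `span_setOf_int_cuspCoeff_eq_top`): the integral forms
span `S_k(Γ₀(N))` over `ℂ`. (2) Bounded denominators: the coefficient functionals `aₙ`, `n ∈ ℕ`,
separate the finite-dimensional space `S_k(Γ₀(N))` (`q`-expansion principle,
`eq_of_forall_cuspCoeff_eq_gamma0`), hence span its dual; a sub-basis `(a_{n_j})_j` of the dual
(`Module.Basis.ofSpan`) has a predual basis `m` of `S_k(Γ₀(N))` with `m.repr v j = a_{n_j}(v)`,
an integer for integral `v`, so `S_k(Γ₀(N); ℤ) ⊆ ⊕ⱼ ℤ mⱼ`. (3) A subgroup of a finitely generated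
free abelian group is free (`Submodule.basisOfPidOfLESpan`): `S_k(Γ₀(N); ℤ)` has a `ℤ`-basis `β`
with `#β ≤ dim S_k(Γ₀(N))`; by (1) `β` spans `S_k(Γ₀(N))` over `ℂ`, so `#β = dim` and `β` is a
`ℂ`-basis (`basisOfTopLeSpanOfCardEqFinrank`); coordinates in a basis being unique, the
`ℂ`-coordinates of an integral form are its integer `β`-coordinates.

## References

* G. Shimura, *Introduction to the arithmetic theory of automorphic functions*, Publ. Math. Soc.
  Japan 11, 1971, Thm. 3.52 and (3.5.20). [Shimura1971]
* A. Agashe, K. A. Ribet, W. A. Stein, *The modular degree, congruence primes, and multiplicity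
  one*, 2012, §2.1 (`S₂(ℤ)`). [AgasheRibetStein2012]
-/

noncomputable section

-- `Summit.ABC.ABC` is the mandated summit-side namespace (single-conjunct summit).
set_option linter.dupNamespace false

open scoped MatrixGroups ModularForm

open CongruenceSubgroup Literature.NumberTheory.EllipticCurves.ModularForms

namespace Summit.ABC.ABC.Theorems.IGCTorsionSharing

section LatticeAlgebra

variable {V : Type*} [AddCommGroup V] [Module ℂ V]

/-- **Full sublattices of the `ℤ`-span of a basis.** If a subgroup `L` of a `ℂ`-vector space `V`
lies in the `ℤ`-span of a finite `ℂ`-basis `m` of `V` and spans `V` over `ℂ`, then `L` has a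
`ℤ`-basis which is a `ℂ`-basis `b` of `V`: every `b i` lies in `L`, and every `v ∈ L` has integer
coordinates in `b` (a subgroup of `ℤʳ` is free of rank `≤ r`, and a spanning family of `dim V`
vectors is a basis). -/
theorem exists_basis_mem_and_repr_intCast {ι : Type*} [Fintype ι] (m : Module.Basis ι ℂ V)
    (L : Submodule ℤ V) (hle : L ≤ Submodule.span ℤ (Set.range m))
    (hL : ⊤ ≤ Submodule.span ℂ (L : Set V)) :
    ∃ (d : ℕ) (b : Module.Basis (Fin d) ℂ V),
      (∀ i, b i ∈ L) ∧ ∀ v ∈ L, ∀ i, ∃ z : ℤ, b.repr v i = (z : ℂ) := by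
  have hind : LinearIndependent ℤ m := m.linearIndependent.restrict_scalars' ℤ
  obtain ⟨n, β⟩ := Submodule.basisOfPidOfLESpan hind hle
  -- every `v ∈ L` is an integer combination of the `β i`
  have hsum : ∀ v (hv : v ∈ L), ∑ i, ((β.repr ⟨v, hv⟩ i : ℤ) : ℂ) • (β i : V) = v := by
    intro v hv
    have h := congrArg L.subtype (β.sum_repr ⟨v, hv⟩)
    rw [map_sum] at h
    simpa only [map_zsmul, Submodule.subtype_apply, Int.cast_smul_eq_zsmul] using h
  -- the `β i` span `V` over `ℂ`
  have hspan : ⊤ ≤ Submodule.span ℂ (Set.range fun i ↦ (β i : V)) := by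
    refine hL.trans (Submodule.span_le.mpr fun v hv ↦ ?_)
    rw [SetLike.mem_coe, ← hsum v hv]
    exact Submodule.sum_mem _ fun i _ ↦
      Submodule.smul_mem _ _ (Submodule.subset_span (Set.mem_range_self i))
  -- and there are `dim V` of them
  have hcard : Fintype.card (Fin n) = Module.finrank ℂ V := by
    refine le_antisymm ?_ (finrank_le_of_span_eq_top (top_le_iff.mp hspan))
    rw [Module.finrank_eq_card_basis m]
    exact (Module.Basis.span hind).card_le_card_of_linearIndependent
      (β.linearIndependent.map' (Submodule.inclusion hle) (Submodule.ker_inclusion L _ hle))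
  set b := basisOfTopLeSpanOfCardEqFinrank (fun i ↦ (β i : V)) hspan hcard
  have hb : ∀ i, b i = (β i : V) := fun i ↦
    congrFun (coe_basisOfTopLeSpanOfCardEqFinrank _ hspan hcard) i
  refine ⟨n, b, fun i ↦ (hb i) ▸ (β i).2, fun v hv i ↦ ⟨β.repr ⟨v, hv⟩ i, ?_⟩⟩
  have key := b.repr_sum_self fun j ↦ ((β.repr ⟨v, hv⟩ j : ℤ) : ℂ)
  have hv' : ∑ j, ((β.repr ⟨v, hv⟩ j : ℤ) : ℂ) • b j = v := by
    simp only [hb]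
    exact hsum v hv
  rw [hv'] at key
  exact congrFun key i

end LatticeAlgebra

section CuspForms

variable (N : ℕ) [NeZero N] (k : ℤ)

/-- **The coefficient functionals span the dual of `S_k(Γ₀(N))`.** The functionals `f ↦ aₙ(f)`,
`n ∈ ℕ`, separate the finite-dimensional space `S_k(Γ₀(N))` (`q`-expansion principle), hence span
`S_k(Γ₀(N))^∨`. -/
theorem span_range_cuspCoeffₗ_eq_top :
    Submodule.span ℂ (Set.range fun n : ℕ ↦
      (cuspCoeffₗ (k := k) (one_mem_strictPeriods_coe_gamma0 N) n :
        Module.Dual ℂ (CuspForm (Gamma0 N) k))) = ⊤ := by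
  haveI := finiteDimensional_cuspForm_gamma0 N k
  refine Submodule.span_eq_top_of_ne_zero fun z hz ↦ ?_
  by_contra! h
  refine hz (eq_of_forall_cuspCoeff_eq_gamma0 fun n ↦ ?_)
  rw [show cuspCoeff (0 : CuspForm (Gamma0 N) k) n = 0 from
    (cuspCoeffₗ (one_mem_strictPeriods_coe_gamma0 N) n).map_zero]
  exact h _ ⟨n, rfl⟩

/-- **Bounded denominators.** `S_k(Γ₀(N))` has a `ℂ`-basis `m` in which every integral cusp form
has integer coordinates, i.e. `S_k(Γ₀(N); ℤ) ⊆ ⊕ⱼ ℤ mⱼ`: the predual basis of a basis of the dual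
space extracted from the coefficient functionals `aₙ`. -/
theorem exists_basis_integralCuspForms0_le_span :
    ∃ (ι : Type) (_ : Fintype ι) (m : Module.Basis ι ℂ (CuspForm (Gamma0 N) k)),
      integralCuspForms0 N k ≤ Submodule.span ℤ (Set.range m) := by
  classical
  haveI := finiteDimensional_cuspForm_gamma0 N k
  have hs := (span_range_cuspCoeffₗ_eq_top N k).ge
  set ε := Module.Basis.ofSpan hs
  haveI := Module.Finite.finite_basis ε
  letI := Fintype.ofFinite ↥((linearIndepOn_empty ℂ id).extend (Set.empty_subset
    (Set.range fun n : ℕ ↦ (cuspCoeffₗ (k := k) (one_mem_strictPeriods_coe_gamma0 N) n :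
      Module.Dual ℂ (CuspForm (Gamma0 N) k)))))
  -- the predual basis `m` of `ε`: `m.repr v j = ε j v`
  set m : Module.Basis _ ℂ (CuspForm (Gamma0 N) k) :=
    ε.dualBasis.map (Module.evalEquiv ℂ (CuspForm (Gamma0 N) k)).symm
  have hm : ∀ v j, m.repr v j = ε j v := fun v j ↦ by
    simp [m]
  -- each `ε j` is a coefficient functional
  have hε : ∀ j, ∃ n : ℕ, (ε j : Module.Dual ℂ (CuspForm (Gamma0 N) k)) =
      cuspCoeffₗ (one_mem_strictPeriods_coe_gamma0 N) n := fun j ↦ by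
    obtain ⟨n, hn⟩ := Module.Basis.ofSpan_subset hs ⟨j, rfl⟩
    exact ⟨n, hn.symm⟩
  refine ⟨_, inferInstance, m, fun v hv ↦ ?_⟩
  rw [Module.Basis.mem_span_iff_repr_mem]
  intro j
  obtain ⟨n, hn⟩ := hε j
  obtain ⟨z, hz⟩ := (mem_integralCuspForms0.mp hv) n
  refine ⟨z, ?_⟩
  rw [hm, hn, cuspCoeffₗ_apply, ← hz, algebraMap_int_eq, Int.coe_castRingHom]

/-- **`S_k(Γ₀(N); ℤ)` is a full lattice of `S_k(Γ₀(N))` (`k ≥ 2`)**: there is a `ℂ`-basis `b` of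
`S_k(Γ₀(N))` consisting of cusp forms with integral Fourier coefficients such that every cusp form
with integral Fourier coefficients has integer coordinates in `b` (equivalently, `b` is a `ℤ`-basis
of `S_k(Γ₀(N); ℤ) = integralCuspForms0 N k`). Shimura 1971, Thm. 3.52 with (3.5.20). -/
theorem exists_latticeBasis_integralCuspForms0 : ∀ (N : ℕ) [NeZero N] (k : ℤ), 2 ≤ k →
    ∃ (d : ℕ) (b : Module.Basis (Fin d) ℂ (CuspForm (CongruenceSubgroup.Gamma0 N) k)),
      (∀ i, b i ∈ Literature.NumberTheory.EllipticCurves.ModularForms.integralCuspForms0 N k) ∧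
      ∀ v ∈ Literature.NumberTheory.EllipticCurves.ModularForms.integralCuspForms0 N k, ∀ i,
        ∃ z : ℤ, b.repr v i = (z : ℂ) := by
  intro N _ k hk
  obtain ⟨ι, _, m, hle⟩ := exists_basis_integralCuspForms0_le_span N k
  refine exists_basis_mem_and_repr_intCast m _ hle ?_
  rw [← span_setOf_int_cuspCoeff_eq_top N k hk]
  refine Submodule.span_mono fun f hf n ↦ ?_
  obtain ⟨z, hz⟩ := hf n
  exact ⟨z, hz.symm⟩

end CuspForms

end Summit.ABC.ABC.Theorems.IGCTorsionSharing

end
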